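import Summits.MatrixMultiplication.OmegaCensus.STPPSmallPatternKernelSearch122R

/-!
# ω-census, small STPP pattern `(1,2,2)^k`: the MIN-FLAG NORMAL FORM (pair-class rank) and its reflection theorem

HONEST FRAMING (pub-omega census; verbatim): lottery ticket; floor = certified bounds/negative ranges.
Census STRUCTURE bookkeeping of the STPP track (seat pub-omega-stpp-3, gen 25; STRUCTURE row B5, column `T2`), not progress on `ω`.

A solution of the `(1,2,2)` difference model with `k` triples has `2k` FLAGS `(i, B)` / `(i, C)`; the flag `(i, B)` carries
the pair of differences `(b'ᵢ − bᵢ, c'ᵢ − cᵢ)`, the flag `(i, C)` the swapped pair (it is the `B`-flag of triple `i` of the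
DUAL solution, `ModelD2.dual`).  Given a PAIR-CLASS RANK `pr u v` (here `prk E cls`: the index of the first mask of the list
`cls` containing the pair code `enc u · n + enc v`) that is invariant under the listed covering / stabiliser maps and under the
signs of both arguments, normalising the solution AT A FLAG OF LEAST RANK (dualise if it is a `C`-flag; translate, cover,
stabilise, orient, sort — `exists_normalForm2_rank`) yields a normal form whose start `(y, c'₀)` has the least rank and in
which EVERY triple's difference pair has rank `≥` that of the start, in both orders.  Consequences
(`not_exists_isSTPP_122_of_search2r`): a start whose swapped pair has strictly smaller rank needs no certificate at all (this
subsumes the `B ↔ C` duality halving of `…Reflect122D`), and the search from a start may skip every triple whose pair class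
ranks below the start (`search2r` with ADEQUATE masks `(XB, XC, PP)`, `STPPSmallPatternKernelSearch122R.lean`).
Measured on `(1,2,2)⁴ ⊄ ℤ/32`: 8 870 s of predicted kernel search instead of 26 700 s (duality only) / 50 400 s (neither).

References: H. Cohn, R. Kleinberg, B. Szegedy, C. Umans, FOCS 2005 (arXiv:math/0511460), Def. 5.1.  Record: pub-omega HOME
`pub-omega-stpp-3-g25/` (planner `plan25a/b/c.py`, mirror `probe_tasks.py`).
-/

namespace Summit.MatrixMultiplication.OmegaCensus

namespace STPP122Neg

open STPP211Neg Literature.Computability.AlgebraicComplexity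

section Refl

variable {G : Type} [AddCommGroup G] {E : GEnc G} {K : ℕ} {b b' c c' : Fin K → G}

/-- NORMAL FORM, TRACKED: a model with `b_{i₀} = c_{i₀} = 0` can be oriented and sorted into `NF2` with triple `i₀` moved to
index `0` keeping `b'_{i₀}, c'_{i₀}`; every new triple `i` is an old triple `σ i` with its two differences kept up to sign. -/
theorem exists_NF2_fixAt_track (E : GEnc G) (hM : ModelD2 b b' c c') (hK : 0 < K) (i0 : Fin K) (hb0 : b i0 = 0)
    (hc0 : c i0 = 0) :
    ∃ p p' q q' : Fin K → G, ∃ σ : Fin K ≃ Fin K, ModelD2 p p' q q' ∧ NF2 E p p' q q' ∧ p ⟨0, hK⟩ = 0 ∧ q ⟨0, hK⟩ = 0 ∧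
      p' ⟨0, hK⟩ = b' i0 ∧ q' ⟨0, hK⟩ = c' i0 ∧ σ ⟨0, hK⟩ = i0 ∧
      ∀ i, SgnEq (p' i - p i) (b' (σ i) - b (σ i)) ∧ SgnEq (q' i - q i) (c' (σ i) - c (σ i)) := by
  set j0 : Fin K := ⟨0, hK⟩
  set b2 : Fin K → G := fun i => if E.enc (b i) < E.enc (b' i) then b i else b' i
  set b2' : Fin K → G := fun i => if E.enc (b i) < E.enc (b' i) then b' i else b i
  set c2 : Fin K → G := fun i => if E.enc (c i) < E.enc (c' i) then c i else c' i
  set c2' : Fin K → G := fun i => if E.enc (c i) < E.enc (c' i) then c' i else c i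
  have hM2 : ModelD2 b2 b2' c2 c2' := hM.orient E
  have hB0 : E.enc (b i0) < E.enc (b' i0) := by
    rw [hb0, E.enc_zero]; refine Nat.pos_of_ne_zero fun h0 => hM.1 i0 ?_
    rw [hb0]; exact (E.enc_inj (h0.trans E.enc_zero.symm)).symm
  have hC0 : E.enc (c i0) < E.enc (c' i0) := by
    rw [hc0, E.enc_zero]; refine Nat.pos_of_ne_zero fun h0 => hM.2.1 i0 ?_
    rw [hc0]; exact (E.enc_inj (h0.trans E.enc_zero.symm)).symm
  have hb2 : b2 i0 = 0 := by
    show (if E.enc (b i0) < E.enc (b' i0) then b i0 else b' i0) = 0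
    rw [if_pos hB0, hb0]
  have hb2' : b2' i0 = b' i0 := by
    show (if E.enc (b i0) < E.enc (b' i0) then b' i0 else b i0) = _
    rw [if_pos hB0]
  have hc2 : c2 i0 = 0 := by
    show (if E.enc (c i0) < E.enc (c' i0) then c i0 else c' i0) = 0
    rw [if_pos hC0, hc0]
  have hc2' : c2' i0 = c' i0 := by
    show (if E.enc (c i0) < E.enc (c' i0) then c' i0 else c i0) = _
    rw [if_pos hC0]
  have hlt2 : ∀ i, E.enc (b2 i) < E.enc (b2' i) ∧ E.enc (c2 i) < E.enc (c2' i) := by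
    intro i
    have hne1 : E.enc (b i) ≠ E.enc (b' i) := fun e => hM.1 i (E.enc_inj e)
    have hne2 : E.enc (c i) ≠ E.enc (c' i) := fun e => hM.2.1 i (E.enc_inj e)
    constructor
    · show E.enc (if E.enc (b i) < E.enc (b' i) then b i else b' i) <
        E.enc (if E.enc (b i) < E.enc (b' i) then b' i else b i)
      split_ifs with h
      · exact h
      · omega
    · show E.enc (if E.enc (c i) < E.enc (c' i) then c i else c' i) <
        E.enc (if E.enc (c i) < E.enc (c' i) then c' i else c i)
      split_ifs with h
      · exact h
      · omega
  have hsg : ∀ i, SgnEq (b2' i - b2 i) (b' i - b i) ∧ SgnEq (c2' i - c2 i) (c' i - c i) := fun i =>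
    ⟨sgnEq_orient E (b i) (b' i), sgnEq_orient E (c i) (c' i)⟩
  set σ := Tuple.sort (fun i => E.enc (b2 i))
  have hmono : Monotone ((fun i => E.enc (b2 i)) ∘ σ) := Tuple.monotone_sort _
  have hM3 : ModelD2 (b2 ∘ σ) (b2' ∘ σ) (c2 ∘ σ) (c2' ∘ σ) := hM2.reindex σ σ.injective
  have hinjb : Function.Injective (fun i => E.enc ((b2 ∘ σ) i)) := by
    intro i j h
    have h' : b2 (σ i) = b2 (σ j) := E.enc_inj h
    have hin : InA b2 b2' (σ j) (b2 (σ i)) := by rw [h']; exact inA_p (σ j)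
    exact σ.injective (hM2.b_disj (inA_p (σ i)) hin)
  have hsm : StrictMono (fun i => E.enc ((b2 ∘ σ) i)) := hmono.strictMono_of_injective hinjb
  have hσ0 : σ j0 = i0 := by
    have hle0 : j0 ≤ σ.symm i0 := by rw [Fin.le_def]; exact Nat.zero_le _
    have hle : E.enc (b2 (σ j0)) ≤ E.enc (b2 (σ (σ.symm i0))) := hmono hle0
    rw [Equiv.apply_symm_apply, hb2, E.enc_zero] at hle
    have h00 : E.enc ((b2 ∘ σ) j0) = E.enc ((b2 ∘ σ) (σ.symm i0)) := by
      show E.enc (b2 (σ j0)) = E.enc (b2 (σ (σ.symm i0))); rw [Equiv.apply_symm_apply, hb2, E.enc_zero]; omega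
    have h3 := congrArg σ (hinjb h00)
    rw [Equiv.apply_symm_apply] at h3
    exact h3
  refine ⟨b2 ∘ σ, b2' ∘ σ, c2 ∘ σ, c2' ∘ σ, σ, hM3,
    ⟨fun i j hij => hsm hij, fun i => (hlt2 (σ i)).1, fun i => (hlt2 (σ i)).2⟩, ?_, ?_, ?_, ?_, hσ0, fun i => hsg (σ i)⟩
  · show b2 (σ j0) = 0; rw [hσ0, hb2]
  · show c2 (σ j0) = 0; rw [hσ0, hc2]
  · show b2' (σ j0) = b' i0; rw [hσ0, hb2']
  · show c2' (σ j0) = c' i0; rw [hσ0, hc2']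

/-- BASE STEP, TRACKED: orienting, translating triple `i₀` to `0` and applying an injective additive map `f` gives a model with
`b_{i₀} = c_{i₀} = 0`, `b'_{i₀} = f (oriented B-difference of i₀)`, and every difference the `f`-image of the old one up to sign. -/
theorem ModelD2.base_track (hM : ModelD2 b b' c c') (E : GEnc G) (i0 : Fin K) (f : G →+ G) (hf : Function.Injective f) :
    ∃ p p' q q' : Fin K → G, ModelD2 p p' q q' ∧ p i0 = 0 ∧ q i0 = 0 ∧
      p' i0 = f ((if E.enc (b i0) < E.enc (b' i0) then b' i0 else b i0) -
        (if E.enc (b i0) < E.enc (b' i0) then b i0 else b' i0)) ∧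
      ∀ i, SgnEq (p' i - p i) (f (b' i - b i)) ∧ SgnEq (q' i - q i) (f (c' i - c i)) := by
  set bo : Fin K → G := fun i => if E.enc (b i) < E.enc (b' i) then b i else b' i
  set bo' : Fin K → G := fun i => if E.enc (b i) < E.enc (b' i) then b' i else b i
  set co : Fin K → G := fun i => if E.enc (c i) < E.enc (c' i) then c i else c' i
  set co' : Fin K → G := fun i => if E.enc (c i) < E.enc (c' i) then c' i else c i
  have hMo : ModelD2 bo bo' co co' := hM.orient E
  refine ⟨fun i => f (bo i - bo i0), fun i => f (bo' i - bo i0), fun i => f (co i - co i0), fun i => f (co' i - co i0),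
    hMo.map_sub f hf (bo i0) (co i0), by simp, by simp, rfl, fun i => ⟨?_, ?_⟩⟩
  · have : f (bo' i - bo i0) - f (bo i - bo i0) = f (bo' i - bo i) := by rw [← AddMonoidHom.map_sub]; congr 1; abel
    rw [this]; exact (sgnEq_orient E (b i) (b' i)).map f
  · have : f (co' i - co i0) - f (co i - co i0) = f (co' i - co i) := by rw [← AddMonoidHom.map_sub]; congr 1; abel
    rw [this]; exact (sgnEq_orient E (c i) (c' i)).map f

/-- **MIN-FLAG NORMAL FORM, CORE**: if triple `i₀` of a model has the least pair rank `m = pr (b'−b) (c'−c)` among all `2k` flags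
(both orders of every triple), then the model has a normal form (translations, covering map, stabiliser map, orientation,
sorting) whose start `(b'₀, c'₀)` has rank `m`, is `good`, and every triple keeps rank `≥ m` in both orders. -/
theorem exists_normalForm2_rank_core (E : GEnc G) (hM : ModelD2 b b' c c') (hK : 0 < K) (pr : G → G → ℕ)
    (hnegl : ∀ u v, pr (-u) v = pr u v) (hnegr : ∀ u v, pr u (-v) = pr u v)
    {dlist : List ℕ} {auts : List (G →+ G)} (hinj : ∀ f ∈ auts, Function.Injective f)
    (hcover : ∀ d : G, d ≠ 0 → ∃ f ∈ auts, E.enc (f d) ∈ dlist) (hprA : ∀ f ∈ auts, ∀ u v, pr (f u) (f v) = pr u v)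
    {stabs : List (G →+ G)} (hsinj : ∀ g ∈ stabs, Function.Injective g) (hprS : ∀ g ∈ stabs, ∀ u v, pr (g u) (g v) = pr u v)
    {good : ℕ → ℕ → Prop} (hgood : ∀ d : G, E.enc d ∈ dlist → ∀ z : G, ∃ g ∈ stabs, g d = d ∧ good (E.enc d) (E.enc (g z)))
    (i0 : Fin K) (hmin : ∀ i, pr (b' i0 - b i0) (c' i0 - c i0) ≤ pr (b' i - b i) (c' i - c i) ∧
      pr (b' i0 - b i0) (c' i0 - c i0) ≤ pr (c' i - c i) (b' i - b i)) :
    ∃ p p' q q' : Fin K → G, ModelD2 p p' q q' ∧ NF2 E p p' q q' ∧ p ⟨0, hK⟩ = 0 ∧ q ⟨0, hK⟩ = 0 ∧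
      E.enc (p' ⟨0, hK⟩) ∈ dlist ∧ good (E.enc (p' ⟨0, hK⟩)) (E.enc (q' ⟨0, hK⟩)) ∧
      ∀ i, pr (p' ⟨0, hK⟩) (q' ⟨0, hK⟩) ≤ pr (p' i - p i) (q' i - q i) ∧
        pr (p' ⟨0, hK⟩) (q' ⟨0, hK⟩) ≤ pr (q' i - q i) (p' i - p i) := by
  set j0 : Fin K := ⟨0, hK⟩
  set m := pr (b' i0 - b i0) (c' i0 - c i0)
  -- the covering map of the oriented B-difference of triple i₀
  set d0 : G := (if E.enc (b i0) < E.enc (b' i0) then b' i0 else b i0) - (if E.enc (b i0) < E.enc (b' i0) then b i0 else b' i0)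
  have hd0 : SgnEq d0 (b' i0 - b i0) := sgnEq_orient E (b i0) (b' i0)
  have hd0ne : d0 ≠ 0 := by
    intro h
    rcases hd0 with e | e
    · exact hM.1 i0 (sub_eq_zero.1 (e ▸ h)).symm
    · have : b' i0 - b i0 = 0 := by rw [← neg_eq_zero, ← e]; exact h
      exact hM.1 i0 (sub_eq_zero.1 this).symm
  obtain ⟨f, hf, hfd⟩ := hcover d0 hd0ne
  -- base step and first sorting
  obtain ⟨p1, p1', q1, q1', hM1, hp10, hq10, hp1', htr1⟩ := hM.base_track E i0 f (hinj f hf)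
  obtain ⟨p2, p2', q2, q2', σ, hM2, -, hp20, hq20, hp2', hq2', hσ0, htr2⟩ :=
    exists_NF2_fixAt_track E hM1 hK i0 hp10 hq10
  have hd2 : E.enc (p2' j0) ∈ dlist := by rw [hp2', hp1']; exact hfd
  -- stabiliser step and second sorting
  obtain ⟨g, hg, hgd, hgz⟩ := hgood (p2' j0) hd2 (q2' j0)
  have hM3 : ModelD2 (fun i => g (p2 i)) (fun i => g (p2' i)) (fun i => g (q2 i)) (fun i => g (q2' i)) :=
    hM2.map g (hsinj g hg)
  obtain ⟨p4, p4', q4, q4', τ, hM4, hNF4, hp40, hq40, hp4', hq4', hτ0, htr4⟩ :=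
    exists_NF2_fixAt_track E hM3 hK j0 (by show g (p2 j0) = 0; rw [hp20, map_zero])
      (by show g (q2 j0) = 0; rw [hq20, map_zero])
  -- rank bookkeeping: every new triple is an old one, through f and g, up to signs
  have hrank : ∀ i, pr (p4' i - p4 i) (q4' i - q4 i) = pr (b' (σ (τ i)) - b (σ (τ i))) (c' (σ (τ i)) - c (σ (τ i))) ∧
      pr (q4' i - q4 i) (p4' i - p4 i) = pr (c' (σ (τ i)) - c (σ (τ i))) (b' (σ (τ i)) - b (σ (τ i))) := by
    intro i
    have hB : SgnEq (p4' i - p4 i) (g (f (b' (σ (τ i)) - b (σ (τ i))))) := by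
      refine (htr4 i).1.trans ?_
      have e1 : g (p2' (τ i)) - g (p2 (τ i)) = g (p2' (τ i) - p2 (τ i)) := (AddMonoidHom.map_sub g _ _).symm
      rw [e1]
      exact (((htr2 (τ i)).1.trans ((htr1 (σ (τ i))).1)).map g)
    have hC : SgnEq (q4' i - q4 i) (g (f (c' (σ (τ i)) - c (σ (τ i))))) := by
      refine (htr4 i).2.trans ?_
      have e1 : g (q2' (τ i)) - g (q2 (τ i)) = g (q2' (τ i) - q2 (τ i)) := (AddMonoidHom.map_sub g _ _).symm
      rw [e1]
      exact (((htr2 (τ i)).2.trans ((htr1 (σ (τ i))).2)).map g)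
    constructor
    · rw [SgnEq.pr_eq hnegl hnegr hB hC, hprS g hg, hprA f hf]
    · rw [SgnEq.pr_eq hnegl hnegr hC hB, hprS g hg, hprA f hf]
  have hstart : pr (p4' j0) (q4' j0) = m := by
    have e1 : p4' j0 = p4' j0 - p4 j0 := by rw [hp40, sub_zero]
    have e2 : q4' j0 = q4' j0 - q4 j0 := by rw [hq40, sub_zero]
    rw [e1, e2, (hrank j0).1, hτ0, hσ0]
  refine ⟨p4, p4', q4, q4', hM4, hNF4, hp40, hq40, ?_, ?_, fun i => ?_⟩
  · rw [hp4']; show E.enc (g (p2' j0)) ∈ dlist; rw [hgd]; exact hd2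
  · rw [hp4', hq4']; show good (E.enc (g (p2' j0))) (E.enc (g (q2' j0))); rw [hgd]; exact hgz
  · rw [hstart, (hrank i).1, (hrank i).2]; exact hmin (σ (τ i))

/-- **MIN-FLAG NORMAL FORM**: every model has a normal form (as in `exists_normalForm2_rank_core`) starting at a triple of least
pair rank among all `2k` flags — the `C`-side flags being reached through the `B ↔ C` DUALITY `ModelD2.dual`. -/
theorem exists_normalForm2_rank (E : GEnc G) (hM : ModelD2 b b' c c') (hK : 0 < K) (pr : G → G → ℕ)
    (hnegl : ∀ u v, pr (-u) v = pr u v) (hnegr : ∀ u v, pr u (-v) = pr u v)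
    {dlist : List ℕ} {auts : List (G →+ G)} (hinj : ∀ f ∈ auts, Function.Injective f)
    (hcover : ∀ d : G, d ≠ 0 → ∃ f ∈ auts, E.enc (f d) ∈ dlist) (hprA : ∀ f ∈ auts, ∀ u v, pr (f u) (f v) = pr u v)
    {stabs : List (G →+ G)} (hsinj : ∀ g ∈ stabs, Function.Injective g) (hprS : ∀ g ∈ stabs, ∀ u v, pr (g u) (g v) = pr u v)
    {good : ℕ → ℕ → Prop} (hgood : ∀ d : G, E.enc d ∈ dlist → ∀ z : G, ∃ g ∈ stabs, g d = d ∧ good (E.enc d) (E.enc (g z))) :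
    ∃ p p' q q' : Fin K → G, ModelD2 p p' q q' ∧ NF2 E p p' q q' ∧ p ⟨0, hK⟩ = 0 ∧ q ⟨0, hK⟩ = 0 ∧
      E.enc (p' ⟨0, hK⟩) ∈ dlist ∧ good (E.enc (p' ⟨0, hK⟩)) (E.enc (q' ⟨0, hK⟩)) ∧
      ∀ i, pr (p' ⟨0, hK⟩) (q' ⟨0, hK⟩) ≤ pr (p' i - p i) (q' i - q i) ∧
        pr (p' ⟨0, hK⟩) (q' ⟨0, hK⟩) ≤ pr (q' i - q i) (p' i - p i) := by
  classical
  set FL : Fin K × Bool → ℕ := fun x => if x.2 then pr (c' x.1 - c x.1) (b' x.1 - b x.1) else pr (b' x.1 - b x.1) (c' x.1 - c x.1)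
  obtain ⟨⟨i0, s⟩, -, hmin⟩ := Finset.exists_min_image Finset.univ FL ⟨(⟨0, hK⟩, false), Finset.mem_univ _⟩
  have hminB : ∀ i, FL (i0, s) ≤ pr (b' i - b i) (c' i - c i) := fun i => by
    simpa [FL] using hmin (i, false) (Finset.mem_univ _)
  have hminC : ∀ i, FL (i0, s) ≤ pr (c' i - c i) (b' i - b i) := fun i => by
    simpa [FL] using hmin (i, true) (Finset.mem_univ _)
  cases s
  · -- the least flag is a B-side flag: normalise the model itself at i₀
    have hm : FL (i0, false) = pr (b' i0 - b i0) (c' i0 - c i0) := by simp [FL]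
    exact exists_normalForm2_rank_core E hM hK pr hnegl hnegr hinj hcover hprA hsinj hprS hgood i0
      fun i => ⟨hm ▸ hminB i, hm ▸ hminC i⟩
  · -- the least flag is a C-side flag: normalise the DUAL model at i₀
    have hm : FL (i0, true) = pr (c' i0 - c i0) (b' i0 - b i0) := by simp [FL]
    have hMd := hM.dual
    refine exists_normalForm2_rank_core E hMd hK pr hnegl hnegr hinj hcover hprA hsinj hprS hgood i0 fun i => ?_
    have e1 : ∀ i, (-c' i - -c i) = -(c' i - c i) := fun i => by abel
    have e2 : ∀ i, (-b' i - -b i) = -(b' i - b i) := fun i => by abel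
    simp only [e1, e2, hnegl, hnegr]
    exact ⟨hm ▸ hminC i, hm ▸ hminB i⟩

/-- Every triple of a model in min-flag normal form has an ALLOWED difference pair for an adequate entry of its start. -/
theorem pairOK_of_adequate {cls : List ℕ} {p p' q q' : Fin K → G} (hM : ModelD2 p p' q q') (hK : 0 < K)
    (hle : ∀ i, prk E cls (p' ⟨0, hK⟩) (q' ⟨0, hK⟩) ≤ prk E cls (p' i - p i) (q' i - q i) ∧
      prk E cls (p' ⟨0, hK⟩) (q' ⟨0, hK⟩) ≤ prk E cls (q' i - q i) (p' i - p i))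
    {e : ℕ × ℕ × ℕ × ℕ × ℕ × ℕ × ℕ} (he1 : e.1 = E.enc (p' ⟨0, hK⟩)) (he2 : e.2.1 = E.enc (q' ⟨0, hK⟩))
    (had : Adequate E.g.n cls e) : PairOK E e.2.2.2.2.1 e.2.2.2.2.2.1 e.2.2.2.2.2.2 p p' q q' := by
  intro i
  have hpos : ∀ {x : G}, x ≠ 0 → 0 < E.enc x := fun {x} hx =>
    Nat.pos_of_ne_zero fun h0 => hx (E.enc_inj (h0.trans E.enc_zero.symm))
  have hb : p' i - p i ≠ 0 := fun h => hM.1 i (sub_eq_zero.1 h).symm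
  have hc : q' i - q i ≠ 0 := fun h => hM.2.1 i (sub_eq_zero.1 h).symm
  exact had (E.enc (p' i - p i)) (hpos hb) (E.enc_lt _) (E.enc (q' i - q i)) (hpos hc) (E.enc_lt _)
    (by rw [he1, he2]; exact (hle i).1) (by rw [he1, he2]; exact (hle i).2)

/-- **REFLECTION THROUGH DEF. 5.1 — MIN-FLAG NORMAL FORM WITH PAIR-CLASS PRUNING** (pattern `(1,2,2)^k`, `k ≥ 2`): covering maps
`mkA i` and stabiliser maps `mkS j` given by parameters (additivity, kernel-triviality, covering, rank-invariance decided on the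
parameter lists), a pair-class list `cls` whose rank is sign-invariant, and for every representative `d` and every `z` a
stabiliser map fixing `d` and carrying `z` to `w` such that EITHER the dual flag is strictly smaller (`rank (w, d) < rank (d, w)`:
such a start is never the least flag) OR the start `(d, w)` is listed in `starts`; every listed start has a `true` pruned search
over ADEQUATE entries (stated in the kernel-decidable bounded form) whose chunk masks cover every pair of codes `(b₁, b'₁)`.  Then the group admits no STPP family of size
pattern `(1,2,2)^k`.  [cite: CohnKleinbergSzegedyUmans2005, Def. 5.1] -/
theorem not_exists_isSTPP_122_of_search2r [DecidableEq G] (E : GEnc G) (hK : 2 ≤ K) (cls : List ℕ)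
    (hneg : ∀ u v : G, prk E cls (-u) v = prk E cls u v ∧ prk E cls u (-v) = prk E cls u v)
    {reps : List ℕ} {ι κ : Type*} (mkA : ι → G → G) (IA : List ι)
    (haddA : ∀ i ∈ IA, ∀ a b : G, mkA i (a + b) = mkA i a + mkA i b) (hkerA : ∀ i ∈ IA, ∀ x : G, mkA i x = 0 → x = 0)
    (hcover : ∀ d : G, d ≠ 0 → ∃ i ∈ IA, E.enc (mkA i d) ∈ reps)
    (hprA : ∀ i ∈ IA, ∀ u v : G, prk E cls (mkA i u) (mkA i v) = prk E cls u v)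
    (mkS : κ → G → G) (IS : List κ)
    (haddS : ∀ j ∈ IS, ∀ a b : G, mkS j (a + b) = mkS j a + mkS j b) (hkerS : ∀ j ∈ IS, ∀ x : G, mkS j x = 0 → x = 0)
    (hprS : ∀ j ∈ IS, ∀ u v : G, prk E cls (mkS j u) (mkS j v) = prk E cls u v)
    {starts : List (ℕ × ℕ)}
    (hstab : ∀ d : G, E.enc d ∈ reps → ∀ z : G, ∃ j ∈ IS, mkS j d = d ∧
      (prk E cls (mkS j z) d < prk E cls d (mkS j z) ∨ (E.enc d, E.enc (mkS j z)) ∈ starts))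
    (hcov : ∀ s ∈ starts, ∃ ch : List (ℕ × ℕ × ℕ × ℕ × ℕ × ℕ × ℕ), search2r E.g K ch = true ∧
      (∀ e ∈ ch, e.1 = s.1 ∧ e.2.1 = s.2 ∧ ∀ u < E.g.n, ∀ v < E.g.n,
        (0 < u ∧ 0 < v ∧ prank cls (e.1 * E.g.n + e.2.1) ≤ prank cls (u * E.g.n + v) ∧
          prank cls (e.1 * E.g.n + e.2.1) ≤ prank cls (v * E.g.n + u)) →
        e.2.2.2.2.1.testBit u = false ∧ e.2.2.2.2.2.1.testBit v = false ∧ e.2.2.2.2.2.2.testBit (u * E.g.n + v) = false) ∧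
      ∀ v₁ < E.g.n, ∀ v₂ < E.g.n, ∃ e ∈ ch, e.2.2.1.testBit v₁ = false ∧ e.2.2.2.1.testBit v₂ = false) :
    ¬ ∃ A B C : Fin K → Finset G, IsSTPP A B C ∧ ∀ i, (A i).card = 1 ∧ (B i).card = 2 ∧ (C i).card = 2 := by
  have hK1 : 0 < K := by omega
  rw [exists_isSTPP_122_iff]
  rintro ⟨p, p', q, q', hb, hc, hU, hX⟩
  have hM : ModelD2 p p' q q' := modelD2_of_finsetForm hb hc hU hX
  -- homs from the parametrised maps
  have haddLA : ∀ f ∈ IA.map mkA, ∀ a b : G, f (a + b) = f a + f b := fun f hf => by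
    obtain ⟨i, hi, rfl⟩ := List.mem_map.1 hf; exact haddA i hi
  have haddLS : ∀ f ∈ IS.map mkS, ∀ a b : G, f (a + b) = f a + f b := fun f hf => by
    obtain ⟨j, hj, rfl⟩ := List.mem_map.1 hf; exact haddS j hj
  set LA : List (G →+ G) := (IA.map mkA).attach.map fun x => AddMonoidHom.mk' x.1 (haddLA x.1 x.2)
  set LS : List (G →+ G) := (IS.map mkS).attach.map fun x => AddMonoidHom.mk' x.1 (haddLS x.1 x.2)
  have memLA : ∀ i ∈ IA, ∃ φ ∈ LA, ⇑φ = mkA i := fun i hi =>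
    exists_mem_attach_map haddLA (List.mem_map.2 ⟨i, hi, rfl⟩)
  have memLS : ∀ j ∈ IS, ∃ φ ∈ LS, ⇑φ = mkS j := fun j hj =>
    exists_mem_attach_map haddLS (List.mem_map.2 ⟨j, hj, rfl⟩)
  have hinjA : ∀ φ ∈ LA, Function.Injective φ := fun φ hφ => by
    obtain ⟨f, hf, hφf⟩ := coe_mem_of_mem_attach_map hφ
    obtain ⟨i, hi, rfl⟩ := List.mem_map.1 hf
    rw [hφf]; exact injective_of_additive_of_ker (haddA i hi) (hkerA i hi)
  have hinjS : ∀ φ ∈ LS, Function.Injective φ := fun φ hφ => by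
    obtain ⟨f, hf, hφf⟩ := coe_mem_of_mem_attach_map hφ
    obtain ⟨j, hj, rfl⟩ := List.mem_map.1 hf
    rw [hφf]; exact injective_of_additive_of_ker (haddS j hj) (hkerS j hj)
  have hprLA : ∀ φ ∈ LA, ∀ u v, prk E cls (φ u) (φ v) = prk E cls u v := fun φ hφ u v => by
    obtain ⟨f, hf, hφf⟩ := coe_mem_of_mem_attach_map hφ
    obtain ⟨i, hi, rfl⟩ := List.mem_map.1 hf
    rw [hφf]; exact hprA i hi u v
  have hprLS : ∀ φ ∈ LS, ∀ u v, prk E cls (φ u) (φ v) = prk E cls u v := fun φ hφ u v => by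
    obtain ⟨f, hf, hφf⟩ := coe_mem_of_mem_attach_map hφ
    obtain ⟨j, hj, rfl⟩ := List.mem_map.1 hf
    rw [hφf]; exact hprS j hj u v
  have hcoverA : ∀ d : G, d ≠ 0 → ∃ φ ∈ LA, E.enc (φ d) ∈ reps := fun d hd => by
    obtain ⟨i, hi, h⟩ := hcover d hd
    obtain ⟨φ, hφ, hφf⟩ := memLA i hi
    exact ⟨φ, hφ, by rw [hφf]; exact h⟩
  -- the min-flag normal form, `good` = «dual flag smaller, or a listed start»
  obtain ⟨r, r', s, s', hMr, hNF, hr0, hs0, -, hgood, hle⟩ := exists_normalForm2_rank E hM hK1 (prk E cls)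
    (fun u v => (hneg u v).1) (fun u v => (hneg u v).2) hinjA hcoverA hprLA hinjS hprLS
    (good := fun y w => prank cls (w * E.g.n + y) < prank cls (y * E.g.n + w) ∨ (y, w) ∈ starts) (fun d hd z => by
      obtain ⟨j, hj, hjd, hrest⟩ := hstab d hd z
      obtain ⟨ψ, hψ, hψg⟩ := memLS j hj
      refine ⟨ψ, hψ, by rw [hψg]; exact hjd, ?_⟩
      rw [hψg]; exact hrest)
  set i0 : Fin K := ⟨0, hK1⟩
  rcases hgood with hlt | hmem
  · -- the dual flag of triple 0 is strictly smaller: contradicts minimality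
    have h := (hle i0).2
    rw [hr0, hs0, sub_zero, sub_zero] at h
    exact absurd hlt (not_lt.2 h)
  · obtain ⟨ch, hsearch, hall, hcover2⟩ := hcov _ hmem
    obtain ⟨e, he, hx1, hx2⟩ := hcover2 (E.enc (r ⟨1, hK⟩)) (E.enc_lt _) (E.enc (r' ⟨1, hK⟩)) (E.enc_lt _)
    obtain ⟨he1, he2, had'⟩ := hall e he
    have had : Adequate E.g.n cls e := fun u hu0 hu v hv0 hv h1 h2 => had' u hu v hv ⟨hu0, hv0, h1, h2⟩
    have hP : PairOK E e.2.2.2.2.1 e.2.2.2.2.2.1 e.2.2.2.2.2.2 r r' s s' := pairOK_of_adequate hMr hK1 hle he1 he2 had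
    have := start2r_of_search2r hsearch e he
    rw [he1, he2, start2r_false hMr hNF hP hK hr0 hs0 hx1 hx2] at this
    exact Bool.false_ne_true this

end Refl

end STPP122Neg

end Summit.MatrixMultiplication.OmegaCensus
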